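import Summits.QuantumFields.BalabanUV.Beta.D1BFx.GhostPinnedTransfer
import Summits.QuantumFields.BalabanUV.Beta.D1BFx.RestKernelGhostDelta

/-!
# `BalabanUV.Beta.D1BFx.RestKernelDeltaGHWiring` — road «BF-x» for binder row D1, slot (K), the ΔGH member («ΔGH-WIRE»):
# **THE PINNED-MINUS-RAY GHOST KERNEL `ΔGH := 2·(PghQ n a (−1) n² 0 − PghQ n a (−1) n² a)` AS A MEMBER OF THE (K) POINTWISE SLOT** — a family `RkDGH ω a n μ ν`
# TOTAL in `n`, carrying a DISPLAYED scalar loop-weight family `ω : ℕ → ℝ`, with the END's `hMR` row (from leaf-01 g20's `GhostPinnedTransfer.absMoment₂_deltaGH`),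
# its `hRu`∕`hU` rows in BOTH readings from leaf-04 g18's UNCONDITIONAL «ΔGH-UNIT» row `RestKernelGhostDelta.abs_secondMoment_deltaGH_le` (the n-free constant
# `KΔ(a)` NAMED `KDgh a`, the `n⁻¹` surplus kept), and the member rewritten as leaf-04's four words (`GhostDeltaWords.deltaGH_eq_words`)

HONEST DEPENDENCY (cell records, verbatim): «continuum YM on T⁴ ⇐ BetaPertH ∧ nine spine estimates (0/9 proved); BetaPertH ⇐ (D1) ∧ (D4) ∧
CAP+tail; G-an2-4 gates asym, D1 and NE2/3/4.»  HONEST FRAMING (cell contract, verbatim): «discharging `BetaPertH` makes Bałaban's UV stability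
UNCONDITIONAL — a real constructive-QFT result; it is NOT the continuum limit and NOT the Clay problem.»  THIS MODULE DISCHARGES NOTHING of the
wall: [folklore] re-indexing (`n = (n−1)+1`, `1 ≤ Lc^m`, homogeneity of the (1.22) moment) over `GhostPinnedTransfer.absMoment₂_deltaGH`, leaf-04's
`RestKernelGhostDelta.abs_secondMoment_deltaGH_le(_unit)` and `GhostDeltaWords.deltaGH_eq_words`, plus three [our object] DATA definitions (`RkDGH` — the weighted member,
total in `n` by `dite`; `KDgh` — FILE 5e's displayed n-free constant, named; `RuDGH` — reading (a)'s `Ru`).  UNCONDITIONAL (`0 < a`); no `def … : Prop`,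
nothing cited, 0 sorry.  It supplies, BY NAME, the `υ`-FRAGMENT `Unit` (the ΔGH member) of the binders `Rk`∕`hMR`∕`hRu`∕`hU` of `RoadEndBFxDictPointwiseS.hdict_of_pointwise`
∕ the JOINT ROOT p314721 — it does NOT touch `hptw`, `hU₁` or any other member of `υ`.  0 root-level binders of row D1 discharged; (K) NOT closed; NOT D1, NOT `BetaPertH`, NOT continuum, NOT Clay.

ABSOLUTE RULE (cell charter, verbatim): «No internally-minted statement may enter as a cited fact. Every hypothesis is either kernel-proved in
this package or a verbatim quotation of a PUBLISHED theorem with page reference. The manuscript(s) under audit are NOT citable for their own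
disputed steps — they are the thing under adjudication; programme-internal (2001/route/tribunal) claims are never citable.»

WHY (OWNER ruling ρ-g16-2 (2) «ΔGH DIRECT»: `Ru := 0`, `CU′` = the direct envelope of leaf-04's «ΔGH-UNIT»; the member and its `hMR` are leaf-01's; g20's handoff (i)).
Same pattern as «RK-GH-WIRE» `RestKernelGhostWiring` p316918 (the twelve `P̂`-words): the END's `Rk : υ → ℕ → …` is TOTAL in `n`, `PghQ n a …` takes `[NeZero n]`,
hence a `dite`; the weight `ω` (the END's `ωgh n` or its CHECK-N0 normalisation, ρ-g15-4) is DISPLAYED and the rows ask only `|ω n| ≤ Ω`.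

CONTENT.
* §1 [our object] `RkDGH ω a n μ ν z`; [folklore] `RkDGH_zero`, **`RkDGH_of_neZero`**, `RkDGH_succ`.
* §2 [folklore] `absMoment₂_RkDGH` (`1 ≤ n`), **`hMR_RkDGH`** (the END's shape `∀ (u : Unit) (m : ℕ), 1 ≤ m → AbsMoment₂ (Rk u (Lc ^ m) μ ν)`, any `ω`, any `[NeZero Lc]`).
* §3 [our object] `KDgh a` (FILE 5e's displayed n-free constant, verbatim); [folklore] `KDgh_nonneg`, **`abs_secondMoment_RkDGH_le`** (`≤ |ω n|·KDgh a·n⁻¹`, `1 ≤ n` —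
  the `n⁻¹` surplus KEPT), `abs_secondMoment_RkDGH_le_unit` (`≤ Ω·KDgh a` under `|ω n| ≤ Ω`); reading (b) = ρ-g16-2 (2): **`hRu_zero_RkDGH`** (`Ru := 0`,
  `CU′ := Ω·KDgh a`), `hU_zero_DGH`; reading (a): [our object] `RuDGH`, [folklore] **`hRu_RuDGH`** (`CU′ := 0`), **`hU_RuDGH`** (`CU := Ω·KDgh a`).
* §4 [folklore] `RkDGH_eq_words_of_neZero` (the member IS `ω n · (−tadpole Ggh W_Q + (QK + KQ + QQ bubbles))` at any `[NeZero n]`, FILE 5a's identity).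
NOT HERE (honest): `hptw`, `hU₁`, every other member of `υ`; any statement about `TshotOf`.
Unit `b2b-balaban-beta-d1-formalise-leaf-01` (gen 21), D1 formalisation swarm leaf prover 01, road «BF-x»; INTENT «ΔGH-WIRE» (journal).
-/

noncomputable section

open Literature.MathematicalPhysics.QuantumFieldTheory.Balaban1983to89
open Literature.MathematicalPhysics.QuantumFieldTheory.Balaban1983to89.Beta
open ExpKernelCalculus (Site)
open DecimatedMomentSummable (AbsMoment₂)
open Summit.QuantumFields.BalabanUV.Beta.D1BFx.GhostKernelComplete (PghQ)
open Summit.QuantumFields.BalabanUV.Beta.D1BFx.GhostPinnedTransfer (absMoment₂_deltaGH)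
open B12Sec2to5 (l1)
open B5Hk163Strip (kappa163)
open B5Hk163Decay (MG163)
open B4TorusKernel (periodConst)
open ExpKernelCalculus (tadpole bubble)
open Summit.QuantumFields.BalabanUV.Beta.D1BFx.RProjector (deltaPP)
open Summit.QuantumFields.BalabanUV.Beta.D1BFx.GhostLeg (Ggh)
open Summit.QuantumFields.BalabanUV.Beta.D1BFx.PointColumnSplit (cG0 cSplit)
open Summit.QuantumFields.BalabanUV.Beta.D1BFx.GhostStencilRooted (SghAt)
open Summit.QuantumFields.BalabanUV.Beta.D1BFx.GhostStencilRootedReflection (ctrHalf)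
open Summit.QuantumFields.BalabanUV.Beta.D1BFx.GhostAveragingSquare (WghAt)
open Summit.QuantumFields.BalabanUV.Beta.D1BFx.ReducedKernelF (vertexRedF)
open Summit.QuantumFields.BalabanUV.Beta.D1BFx.ReducedTableF (tableRedF)
open Summit.QuantumFields.BalabanUV.Beta.D1BFx.GhostDeltaWords (deltaGH_eq_words)
open Summit.QuantumFields.BalabanUV.Beta.D1BFx.RestKernelGhostDelta (abs_secondMoment_deltaGH_le abs_secondMoment_deltaGH_le_unit)

namespace Summit.QuantumFields.BalabanUV.Beta.D1BFx.RestKernelDeltaGHWiring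

/-! ## §1 The member, TOTAL in the block size -/

/-- [our object] **THE ΔGH MEMBER OF THE (K) SLOT**: `RkDGH ω a n μ ν z := ω n · 2·(PghQ n a (−1) n² 0 μ ν z − PghQ n a (−1) n² a μ ν z)` for `n ≠ 0`
(`ω : ℕ → ℝ` a DISPLAYED scalar loop-weight family — the END's `ωgh n` or its CHECK-N0 normalisation, the consumer's), `0` at the junk block size `n = 0`.
A DEFINITION; asserts nothing. -/
def RkDGH (ω : ℕ → ℝ) (a : ℝ) (n : ℕ) (μ ν : Fin 4) (z : Site 4) : ℝ :=
  if h : n = 0 then 0 else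
    haveI : NeZero n := ⟨h⟩
    ω n * (2 * (PghQ n a (-1) (((n : ℝ) ^ 2)) 0 μ ν z - PghQ n a (-1) (((n : ℝ) ^ 2)) a μ ν z))

/-- [our object] The junk value. -/
theorem RkDGH_zero (ω : ℕ → ℝ) (a : ℝ) : RkDGH ω a 0 = fun _ _ _ => 0 := by
  funext μ ν z
  simp [RkDGH]

/-- [folklore] **AT ANY `[NeZero n]` THE MEMBER IS THE ω-WEIGHTED ΔGH KERNEL OF RECORD** (`NeZero` is a `Prop`-class: the manufactured and the ambient
instance agree). -/
theorem RkDGH_of_neZero (ω : ℕ → ℝ) (a : ℝ) (n : ℕ) [NeZero n] :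
    RkDGH ω a n = fun μ ν z => ω n * (2 * (PghQ n a (-1) (((n : ℝ) ^ 2)) 0 μ ν z - PghQ n a (-1) (((n : ℝ) ^ 2)) a μ ν z)) := by
  funext μ ν z
  rw [RkDGH, dif_neg (NeZero.ne n)]

/-- [folklore] … in the `n := m + 1` indexing. -/
theorem RkDGH_succ (ω : ℕ → ℝ) (a : ℝ) (m : ℕ) :
    RkDGH ω a (m + 1) = fun μ ν z => ω (m + 1) *
      (2 * (PghQ (m + 1) a (-1) ((((m + 1 : ℕ) : ℝ) ^ 2)) 0 μ ν z - PghQ (m + 1) a (-1) ((((m + 1 : ℕ) : ℝ) ^ 2)) a μ ν z)) :=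
  RkDGH_of_neZero ω a (m + 1)

/-! ## §2 The `hMR` row -/

section Rows

variable (ω : ℕ → ℝ) {a : ℝ} (ha : 0 < a)
include ha

/-- [folklore] The member has an absolutely summable second moment at every `n ≥ 1` (`GhostPinnedTransfer.absMoment₂_deltaGH` at the weight `ω n`). -/
theorem absMoment₂_RkDGH {n : ℕ} (hn : 1 ≤ n) (μ ν : Fin 4) : AbsMoment₂ (RkDGH ω a n μ ν) := by
  haveI : NeZero n := ⟨by omega⟩
  rw [RkDGH_of_neZero]
  exact absMoment₂_deltaGH n a ha (ω n) μ ν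

/-- [folklore] **THE END's `hMR` ROW FOR THE ΔGH MEMBER**, in the shape `RoadEndBFxDictPointwiseS.hdict_of_pointwise` displays it at `υ := Unit`,
`Rk := fun _ => RkDGH ω a` (any weight, any `[NeZero Lc]`, since `1 ≤ Lc ^ m`). -/
theorem hMR_RkDGH {Lc : ℕ} [NeZero Lc] (μ ν : Fin 4) :
    ∀ (_u : Unit) (m : ℕ), 1 ≤ m → AbsMoment₂ ((fun _ : Unit => RkDGH ω a) _u (Lc ^ m) μ ν) :=
  fun _ m _ => absMoment₂_RkDGH ω ha (Nat.one_le_pow m Lc (Nat.pos_of_ne_zero (NeZero.ne Lc))) μ ν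

end Rows

/-! ## §3 The read-out rows: `KΔ(a)` named, the `n⁻¹` surplus, both readings of `Ru` -/

/-- [our object] **`KΔ(a)`** — leaf-04 g18's displayed n-free constant of `RestKernelGhostDelta.abs_secondMoment_deltaGH_le(_unit)`, VERBATIM, given a name
(the qSq tadpole + the QK∕KQ bubbles + the QQ bubble, × the moment sum at rate `σ₀`).  A DEFINITION of a real number; asserts nothing. -/
def KDgh (a : ℝ) : ℝ :=
  ((cG0 4 + cSplit 4 a) * (|a| * (64 * Real.exp (kappa163 (3 + 1) / (3 + 1)) *
        ((MG163 (3 + 1) * periodConst (kappa163 (3 + 1)) 3) * Real.exp (kappa163 (3 + 1) / (3 + 1))) ^ 2 * (1 + 16 / (kappa163 (3 + 1) / (3 + 1))) ^ 4))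
    + 2 * ((2 / min 2 a) * (cG0 4 + cSplit 4 a)
        * (|a| * (8 * Real.exp (kappa163 (3 + 1) / (3 + 1)) *
            ((MG163 (3 + 1) * periodConst (kappa163 (3 + 1)) 3) * Real.exp (kappa163 (3 + 1) / (3 + 1))) * (1 + 16 / (kappa163 (3 + 1) / (3 + 1))) ^ 4))
        * (8 * Real.exp (kappa163 (3 + 1) / (3 + 1) / 16) * (MG163 (3 + 1) * periodConst (kappa163 (3 + 1)) 3) * Real.exp (kappa163 (3 + 1) / (3 + 1))
            * (1 + 16 / (kappa163 (3 + 1) / (3 + 1))) ^ 4))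
    + (2 / min 2 a) * (cG0 4 + cSplit 4 a)
        * (|a| * (8 * Real.exp (kappa163 (3 + 1) / (3 + 1)) *
            ((MG163 (3 + 1) * periodConst (kappa163 (3 + 1)) 3) * Real.exp (kappa163 (3 + 1) / (3 + 1))) * (1 + 16 / (kappa163 (3 + 1) / (3 + 1))) ^ 4)) ^ 2)
    * ∑' x : Site 4, l1 x ^ 2 * Real.exp (-(min (deltaPP 4 a / 8) (kappa163 (3 + 1) / (3 + 1) / 16)) * l1 x)

section ReadOut

variable (ω : ℕ → ℝ) {a : ℝ} (ha : 0 < a)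
include ha

/-- [folklore] `0 ≤ KΔ(a)` (it dominates an absolute value: FILE 5e's unit row at `m = 0`). -/
theorem KDgh_nonneg : 0 ≤ KDgh a :=
  (abs_nonneg _).trans (abs_secondMoment_deltaGH_le_unit 0 ha 0 0)

/-- [folklore] **THE `n⁻¹` SURPLUS, KEPT**: `|secondMoment (RkDGH ω a n) μ ν| ≤ |ω n|·(KΔ(a)·n⁻¹)` for every `n ≥ 1` (FILE 5e's `abs_secondMoment_deltaGH_le`
re-indexed by `n = (n − 1) + 1`; the (1.22) moment is homogeneous in the kernel). -/
theorem abs_secondMoment_RkDGH_le {n : ℕ} (hn : 1 ≤ n) (μ ν : Fin 4) :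
    |B12Beta.secondMoment (RkDGH ω a n) μ ν| ≤ |ω n| * (KDgh a * ((n : ℝ))⁻¹) := by
  obtain ⟨m, rfl⟩ : ∃ m, n = m + 1 := ⟨n - 1, (Nat.sub_add_cancel hn).symm⟩
  rw [RkDGH_succ]
  have hhom : ∀ (c : ℝ) (P : B12Beta.Kernel 4), B12Beta.secondMoment (fun μ' ν' z => c * P μ' ν' z) μ ν = c * B12Beta.secondMoment P μ ν :=
    fun c P => by
      simp only [B12Beta.secondMoment, ← tsum_mul_left]
      exact tsum_congr fun z => by ring
  rw [hhom (ω (m + 1)) (fun μ' ν' z => 2 * (PghQ (m + 1) a (-1) ((((m + 1 : ℕ) : ℝ) ^ 2)) 0 μ' ν' z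
    - PghQ (m + 1) a (-1) ((((m + 1 : ℕ) : ℝ) ^ 2)) a μ' ν' z)), abs_mul]
  exact mul_le_mul_of_nonneg_left (abs_secondMoment_deltaGH_le m ha μ ν) (abs_nonneg _)

/-- [folklore] **THE n-UNIFORM UNIT ROW** under a displayed weight bound `|ω n| ≤ Ω`: `|secondMoment (RkDGH ω a n) μ ν| ≤ Ω·KΔ(a)` for every `n ≥ 1`. -/
theorem abs_secondMoment_RkDGH_le_unit {Ω : ℝ} (hω : ∀ n, |ω n| ≤ Ω) {n : ℕ} (hn : 1 ≤ n) (μ ν : Fin 4) :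
    |B12Beta.secondMoment (RkDGH ω a n) μ ν| ≤ Ω * KDgh a := by
  have hK := KDgh_nonneg ha
  have hn1 : (1 : ℝ) ≤ (n : ℝ) := by exact_mod_cast hn
  have hN : ((n : ℝ))⁻¹ ≤ 1 := inv_le_one_of_one_le₀ hn1
  calc |B12Beta.secondMoment (RkDGH ω a n) μ ν| ≤ |ω n| * (KDgh a * ((n : ℝ))⁻¹) := abs_secondMoment_RkDGH_le ω ha hn μ ν
    _ ≤ Ω * (KDgh a * 1) :=
        mul_le_mul (hω n) (mul_le_mul_of_nonneg_left hN hK) (by positivity) ((abs_nonneg _).trans (hω n))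
    _ = Ω * KDgh a := by rw [mul_one]

/-- [folklore] READING (b) = OWNER RULING ρ-g16-2 (2) («`Ru := 0`, `CU′` = the direct envelope»), **THE END's `hRu` ROW** (`0 < a`, `|ω n| ≤ Ω`; any `[NeZero Lc]`):
`|secondMoment (RkDGH ω a (Lc ^ m)) μ ν − 0| ≤ Ω·KΔ(a)` for every `m ≥ 1`. -/
theorem hRu_zero_RkDGH {Lc : ℕ} [NeZero Lc] {Ω : ℝ} (hω : ∀ n, |ω n| ≤ Ω) (μ ν : Fin 4) :
    ∀ (_u : Unit) (m : ℕ), 1 ≤ m →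
      |B12Beta.secondMoment ((fun _ : Unit => RkDGH ω a) _u (Lc ^ m)) μ ν - (fun (_ : Unit) (_ : ℕ) => (0 : ℝ)) _u (Lc ^ m)| ≤ (fun _ : Unit => Ω * KDgh a) _u := by
  intro _ m _
  simp only [sub_zero]
  exact abs_secondMoment_RkDGH_le_unit ω ha hω (Nat.one_le_pow m Lc (Nat.pos_of_ne_zero (NeZero.ne Lc))) μ ν

omit ha in
/-- [folklore] READING (b), the `hU` row is vacuous: `|0| ≤ 0`. -/
theorem hU_zero_DGH : ∀ n : ℕ, 2 ≤ n → ∀ u : Unit, |(fun (_ : Unit) (_ : ℕ) => (0 : ℝ)) u n| ≤ (fun _ : Unit => (0 : ℝ)) u :=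
  fun _ _ _ => by simp

end ReadOut

/-- [our object] READING (a): the ΔGH fragment of the END's `Ru` at the fixed channel `μ ν` is the second moment of the weighted member itself.  A DEFINITION; asserts nothing. -/
def RuDGH (ω : ℕ → ℝ) (a : ℝ) (μ ν : Fin 4) : Unit → ℕ → ℝ := fun _ n => B12Beta.secondMoment (RkDGH ω a n) μ ν

section ReadingA

variable (ω : ℕ → ℝ) {a : ℝ}

/-- [folklore] READING (a), **THE END's `hRu` ROW** with `CU′ := 0`. -/
theorem hRu_RuDGH {Lc : ℕ} (μ ν : Fin 4) :
    ∀ (u : Unit) (m : ℕ), 1 ≤ m →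
      |B12Beta.secondMoment ((fun _ : Unit => RkDGH ω a) u (Lc ^ m)) μ ν - RuDGH ω a μ ν u (Lc ^ m)| ≤ (fun _ : Unit => (0 : ℝ)) u := by
  intro u m _
  simp [RuDGH]

/-- [folklore] READING (a), **THE END's `hU` ROW** with `CU := Ω·KΔ(a)` (`0 < a`, `|ω n| ≤ Ω`). -/
theorem hU_RuDGH (ha : 0 < a) {Ω : ℝ} (hω : ∀ n, |ω n| ≤ Ω) (μ ν : Fin 4) :
    ∀ n : ℕ, 2 ≤ n → ∀ u : Unit, |RuDGH ω a μ ν u n| ≤ (fun _ : Unit => Ω * KDgh a) u :=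
  fun _ hn _ => abs_secondMoment_RkDGH_le_unit ω ha hω (le_trans one_le_two hn) μ ν

end ReadingA

/-! ## §4 The member as leaf-04's four words (what the dictionary will quote) -/

/-- [folklore] **THE ΔGH MEMBER IS `ω n · (−qSq TADPOLE + QK + KQ + QQ BUBBLES)`** at any `[NeZero n]` (`0 < a`): FILE 5a's `deltaGH_eq_words` under the weight
(`V_K := vertexRedF n (SghAt ρ n n² 0)`, `V_Q := vertexRedF n (SghAt ρ n 0 a)`, `W_Q := tableRedF n (WghAt ρ n (−1) 0 a)`, `ρ = ctrHalf n`). -/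
theorem RkDGH_eq_words_of_neZero (ω : ℕ → ℝ) {a : ℝ} (ha : 0 < a) (n : ℕ) [NeZero n] (μ ν : Fin 4) (z : Site 4) :
    RkDGH ω a n μ ν z = ω n * (-tadpole (Ggh n a) (tableRedF n (WghAt (ctrHalf n) n (-1) 0 a) μ 0 ν z)
        + (bubble (Ggh n a) (vertexRedF n (SghAt (ctrHalf n) n 0 a) μ 0) (vertexRedF n (SghAt (ctrHalf n) n (((n : ℝ) ^ 2)) 0) ν z)
          + bubble (Ggh n a) (vertexRedF n (SghAt (ctrHalf n) n (((n : ℝ) ^ 2)) 0) μ 0) (vertexRedF n (SghAt (ctrHalf n) n 0 a) ν z)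
          + bubble (Ggh n a) (vertexRedF n (SghAt (ctrHalf n) n 0 a) μ 0) (vertexRedF n (SghAt (ctrHalf n) n 0 a) ν z))) := by
  simp only [RkDGH_of_neZero, deltaGH_eq_words n ha μ ν z]

end Summit.QuantumFields.BalabanUV.Beta.D1BFx.RestKernelDeltaGHWiring

end
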